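import Summits.CriticalPhenomena.PercolationContinuityZ3.Theorems.PercNearOneGluingNoHeavyLowerTailSahiClassTCoreStep
import Mathlib.Tactic.Linarith
import HarnessLib

/-!
# `NoHeavyLowerTail` (crux stmt-CriticalPhenomena-4575), P2 — **THE CHORD CRITERION**: Kahn's Conjecture 5 follows if, at every parameter point, `E_3` lies above its
# chord in ONE essential coordinate direction of every core triple

Support file (seat `prim-masterthm-p2`, gen 14; `--supports stmt-CriticalPhenomena-4575`).  No definition, no `sorry`, standard axioms.
Engine: `SahiClassTCube.sahiE_three_nonneg_of_core_step` (`…SahiClassTCoreStep`).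

For a triple `U` of increasing events on the cube `2^κ`, a coordinate `e` with `t = p_e` and the section triples `U⁰ = (secAt e false U_j)_j`,
`U¹ = (secAt e true U_j)_j`, the polynomial `t ↦ E_3(μ_p; U)` is a cubic whose values at `t = 0, 1` are `E_3(U⁰), E_3(U¹)`; its deviation from the chord is
  `B_e := E_3(U) − (1 − t)·E_3(U⁰) − t·E_3(U¹) = t(1−t)·[Σ_i δ_i·Δ_{jk} − Σ_i μ_p(U_i)·δ_j·δ_k − (1 − 2t)·δ_0δ_1δ_2]`
(`δ_i = μ(U_i¹) − μ(U_i⁰)` the pivotality of `e` for `U_i`, `Δ_{jk}` that for `U_j ∩ U_k`; identity checked exactly by the seat, not formalised here).  For the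
covariance the analogous deviation is `t(1−t)δ_fδ_g ≥ 0` in EVERY direction (the inductive proof of Harris' inequality); for `E_3` it is negative in about 5 % of
the directions (seat census), but in every one of ~10⁸ tested (triple, p) pairs (exhaustive on `2^4` over a p-grid, annealed search on `2^5, 2^6`) SOME essential
coordinate has `B_e ≥ 0` — while the averaged form `Σ_e B_e ≥ 0` is FALSE (e.g. `(M, x_0 ∨ M, x_0 ∨ x_1x_2x_3)`, `M = x_1⋯x_5`, `p ≡ ½`).

* **`masterFamilyNonneg_three_of_core_chord`** — if every CORE triple (a coordinate essential to all three members; no canalyzing and no private essential coordinate)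
  has, at every `p`, an essential coordinate `e` with `(1 − p_e)·E_3(μ_p; U⁰) + p_e·E_3(μ_p; U¹) ≤ E_3(μ_p; U)`, then Kahn's Conjecture 5 (`MasterFamilyNonneg 3`) holds —
  the induction on the total essential support is immediate since both section triples are increasing with smaller support.
* `masterFamilyNonneg_three_of_chord` — the same with the hypothesis on all non-constant triples; `kahnConjecture_of_core_chord` — `KahnConjecture` form.
HONEST FRAMING: a reduction to an UNPROVED (new, census-backed) criterion; nothing here proves `C_3`. [this work]
-/

noncomputable section

open scoped Classical

namespace Summit.CriticalPhenomena.PercolationContinuityZ3.Theorems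

namespace SahiClassTCube

open Finset Function
open Literature.Combinatorics.Sahi2008
open Literature.Probability.Percolation.DecisionTree (ind)

variable {κ : Type} [Fintype κ]

/-- **Kahn's Conjecture 5 ⟸ a chord coordinate in every core triple**: if every core triple of increasing events has, at every parameter point `p`, an essential
coordinate `e` in whose direction `E_3` lies above its chord, `(1 − p_e)·E_3(U⁰_e) + p_e·E_3(U¹_e) ≤ E_3(U)`, then `MasterFamilyNonneg 3`. [this work] -/
theorem masterFamilyNonneg_three_of_core_chord
    (hchord : ∀ (κ : Type) [Fintype κ] (p : κ → unitInterval) (U : Fin 3 → Set (Set κ)), (∀ j, IsUpperSet (U j)) →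
      (∃ x, x ∈ esupp (U 0) ∧ x ∈ esupp (U 1) ∧ x ∈ esupp (U 2)) →
      (∀ j x, x ∈ esupp (U j) → ¬ ({ω : Set κ | x ∈ ω} ⊆ U j) ∧ ¬ (U j ⊆ {ω : Set κ | x ∈ ω})) →
      (∀ j x, x ∈ esupp (U j) → ∃ j', j' ≠ j ∧ x ∈ esupp (U j')) →
      ∃ (e : κ) (j : Fin 3), e ∈ esupp (U j) ∧
        (1 - (p e : ℝ)) * sahiE (bernoulliWeight p) 3 (fun i => ind (secAt e false (U i)))
            + (p e : ℝ) * sahiE (bernoulliWeight p) 3 (fun i => ind (secAt e true (U i)))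
          ≤ sahiE (bernoulliWeight p) 3 (fun i => ind (U i))) :
    MasterFamilyNonneg 3 := by
  intro κ _ p U hU
  refine sahiE_three_nonneg_of_core_step p (fun V hV h1 h2 h3 ih => ?_) U hU
  obtain ⟨e, j, he, hle⟩ := hchord κ p V hV h1 h2 h3
  have E0 := ih (fun k => secAt e false (V k)) (fun k => isUpperSet_secAt e false (hV k)) (sum_card_esupp_secAt_lt V hV he false)
  have E1 := ih (fun k => secAt e true (V k)) (fun k => isUpperSet_secAt e true (hV k)) (sum_card_esupp_secAt_lt V hV he true)
  have ht0 : 0 ≤ (p e : ℝ) := (p e).2.1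
  have ht1 : 0 ≤ 1 - (p e : ℝ) := sub_nonneg.2 (p e).2.2
  have a0 := mul_nonneg ht1 E0
  have a1 := mul_nonneg ht0 E1
  linarith

/-- **Kahn's Conjecture 5 ⟸ a chord coordinate in every non-constant triple** (the hypothesis of `masterFamilyNonneg_three_of_core_chord` asked of all triples with an
essential coordinate). [this work] -/
theorem masterFamilyNonneg_three_of_chord
    (hchord : ∀ (κ : Type) [Fintype κ] (p : κ → unitInterval) (U : Fin 3 → Set (Set κ)), (∀ j, IsUpperSet (U j)) →
      (∃ (j : Fin 3) (x : κ), x ∈ esupp (U j)) →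
      ∃ (e : κ) (j : Fin 3), e ∈ esupp (U j) ∧
        (1 - (p e : ℝ)) * sahiE (bernoulliWeight p) 3 (fun i => ind (secAt e false (U i)))
            + (p e : ℝ) * sahiE (bernoulliWeight p) 3 (fun i => ind (secAt e true (U i)))
          ≤ sahiE (bernoulliWeight p) 3 (fun i => ind (U i))) :
    MasterFamilyNonneg 3 :=
  masterFamilyNonneg_three_of_core_chord fun κ _ p U hU h1 _ _ => by
    obtain ⟨x, hx, _, _⟩ := h1
    exact hchord κ p U hU ⟨0, x, hx⟩

/-- **`KahnConjecture` ⟸ a chord coordinate in every core triple.** [this work] -/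
theorem kahnConjecture_of_core_chord
    (hchord : ∀ (κ : Type) [Fintype κ] (p : κ → unitInterval) (U : Fin 3 → Set (Set κ)), (∀ j, IsUpperSet (U j)) →
      (∃ x, x ∈ esupp (U 0) ∧ x ∈ esupp (U 1) ∧ x ∈ esupp (U 2)) →
      (∀ j x, x ∈ esupp (U j) → ¬ ({ω : Set κ | x ∈ ω} ⊆ U j) ∧ ¬ (U j ⊆ {ω : Set κ | x ∈ ω})) →
      (∀ j x, x ∈ esupp (U j) → ∃ j', j' ≠ j ∧ x ∈ esupp (U j')) →
      ∃ (e : κ) (j : Fin 3), e ∈ esupp (U j) ∧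
        (1 - (p e : ℝ)) * sahiE (bernoulliWeight p) 3 (fun i => ind (secAt e false (U i)))
            + (p e : ℝ) * sahiE (bernoulliWeight p) 3 (fun i => ind (secAt e true (U i)))
          ≤ sahiE (bernoulliWeight p) 3 (fun i => ind (U i))) :
    KahnConjecture :=
  masterFamilyNonneg_three_iff_kahnConjecture.1 (masterFamilyNonneg_three_of_core_chord hchord)


/-! ### Appendix (same generation): the chord criterion ON AVERAGE over the essential coordinates

Seat census (jobs/bex, exact re-checks): the plain average `Σ_e B_e ≥ 0` FAILS on meet-contained triples (e.g. `(M, x_0 ∨ M, x_0 ∨ x_1x_2x_3)`), but on CORE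
triples an annealed search at `k = 5, 6` (5·10⁵ core evaluations aimed at minimising it) never brought `Σ_e B_e / Σ_e |B_e|` below `≈ 0.18`.  At `p ≡ ½` the
average form is the level-1 Fourier inequality `Σ_i ⟨U_i, U_j ∩ U_k⟩₁ ≥ Σ_i μ(U_i)·⟨U_j, U_k⟩₁`. -/

/-- **Kahn's Conjecture 5 ⟸ the chord criterion ON AVERAGE over the essential coordinates of every core triple**: if for every core triple and every `p`
`Σ_{e ∈ esupp U_0 ∪ esupp U_1 ∪ esupp U_2} [E_3(U) − (1 − p_e)·E_3(U⁰_e) − p_e·E_3(U¹_e)] ≥ 0`, then `MasterFamilyNonneg 3` (a nonnegative sum over a nonempty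
finset has a nonnegative term; then `masterFamilyNonneg_three_of_core_chord`). [this work] -/
theorem masterFamilyNonneg_three_of_core_chordAverage
    (havg : ∀ (κ : Type) [Fintype κ] (p : κ → unitInterval) (U : Fin 3 → Set (Set κ)), (∀ j, IsUpperSet (U j)) →
      (∃ x, x ∈ esupp (U 0) ∧ x ∈ esupp (U 1) ∧ x ∈ esupp (U 2)) →
      (∀ j x, x ∈ esupp (U j) → ¬ ({ω : Set κ | x ∈ ω} ⊆ U j) ∧ ¬ (U j ⊆ {ω : Set κ | x ∈ ω})) →
      (∀ j x, x ∈ esupp (U j) → ∃ j', j' ≠ j ∧ x ∈ esupp (U j')) →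
      0 ≤ ∑ e ∈ esupp (U 0) ∪ esupp (U 1) ∪ esupp (U 2),
        (sahiE (bernoulliWeight p) 3 (fun i => ind (U i))
          - ((1 - (p e : ℝ)) * sahiE (bernoulliWeight p) 3 (fun i => ind (secAt e false (U i)))
              + (p e : ℝ) * sahiE (bernoulliWeight p) 3 (fun i => ind (secAt e true (U i)))))) :
    MasterFamilyNonneg 3 := by
  refine masterFamilyNonneg_three_of_core_chord (fun κ _ p U hU h1 h2 h3 => ?_)
  have hs := havg κ p U hU h1 h2 h3
  obtain ⟨x, hx0, -, -⟩ := h1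
  have hne : (esupp (U 0) ∪ esupp (U 1) ∪ esupp (U 2)).Nonempty :=
    ⟨x, Finset.mem_union_left _ (Finset.mem_union_left _ hx0)⟩
  set g : κ → ℝ := fun e => sahiE (bernoulliWeight p) 3 (fun i => ind (U i))
      - ((1 - (p e : ℝ)) * sahiE (bernoulliWeight p) 3 (fun i => ind (secAt e false (U i)))
          + (p e : ℝ) * sahiE (bernoulliWeight p) 3 (fun i => ind (secAt e true (U i)))) with hg
  have H : ∑ e ∈ esupp (U 0) ∪ esupp (U 1) ∪ esupp (U 2), (fun _ : κ => (0 : ℝ)) e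
      ≤ ∑ e ∈ esupp (U 0) ∪ esupp (U 1) ∪ esupp (U 2), g e := by
    rw [Finset.sum_const_zero]; exact hs
  obtain ⟨e, he, hle⟩ := Finset.exists_le_of_sum_le hne H
  simp only [hg] at hle
  simp only [Finset.mem_union] at he
  rcases he with (h | h) | h
  · exact ⟨e, 0, h, by linarith⟩
  · exact ⟨e, 1, h, by linarith⟩
  · exact ⟨e, 2, h, by linarith⟩

/-- **`KahnConjecture` ⟸ the chord criterion on average over the essential coordinates of every core triple.** [this work] -/
theorem kahnConjecture_of_core_chordAverage
    (havg : ∀ (κ : Type) [Fintype κ] (p : κ → unitInterval) (U : Fin 3 → Set (Set κ)), (∀ j, IsUpperSet (U j)) →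
      (∃ x, x ∈ esupp (U 0) ∧ x ∈ esupp (U 1) ∧ x ∈ esupp (U 2)) →
      (∀ j x, x ∈ esupp (U j) → ¬ ({ω : Set κ | x ∈ ω} ⊆ U j) ∧ ¬ (U j ⊆ {ω : Set κ | x ∈ ω})) →
      (∀ j x, x ∈ esupp (U j) → ∃ j', j' ≠ j ∧ x ∈ esupp (U j')) →
      0 ≤ ∑ e ∈ esupp (U 0) ∪ esupp (U 1) ∪ esupp (U 2),
        (sahiE (bernoulliWeight p) 3 (fun i => ind (U i))
          - ((1 - (p e : ℝ)) * sahiE (bernoulliWeight p) 3 (fun i => ind (secAt e false (U i)))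
              + (p e : ℝ) * sahiE (bernoulliWeight p) 3 (fun i => ind (secAt e true (U i)))))) :
    KahnConjecture :=
  masterFamilyNonneg_three_iff_kahnConjecture.1 (masterFamilyNonneg_three_of_core_chordAverage havg)


/-! ### Census correction (same session, later)

The hypothesis of `masterFamilyNonneg_three_of_core_chordAverage` — the PLAIN average `Σ_e B_e ≥ 0` on core triples at EVERY `p` — is FALSE as stated: exact witness on `2^6`,
`U = (x₁x₃ ∨ x₁x₂x₄ ∨ x₂x₃x₄x₅, x₀x₁ ∨ x₁x₃ ∨ x₂x₃ ∨ x₀x₂x₄ ∨ x₀x₅, x₁x₂ ∨ x₀x₅ ∨ x₁x₅ ∨ x₃x₄x₅)`, `p = (19/20, 1/20, 1/20, 1/10, 1/5, 19/20)`: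
`Σ_e B_e = −1.14·10⁻⁴ < 0 < max_e B_e = +5.98·10⁻⁵` (a core triple; at `p ≡ ½` no core failure of the average is known).  The reduction stays correct but idle; the
live hypotheses are the ∃-forms: `masterFamilyNonneg_three_of_core_chord` ((B∃): 0 violations in ≈ 1.2·10¹⁰ (triple, p) evaluations, kit j143682) and the stronger,
`p_e`-independent "core axis-convexity" `∃ e, Σ_i δ_i[Cov(U_j¹,U_k¹) − Cov(U_j⁰,U_k⁰)] + Σ_i μ(U_i⁰)δ_jδ_k ≥ 0` (0 violations in 1.1·10⁶ directed core evaluations), which gives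
`T⁺_e ≥ E_3(U⁰)+E_3(U¹)+δ₀δ₁δ₂` and hence `B_e ≥ 0` for every `p_e` (seat memo SAHI-ROUTE §4.38). -/

end SahiClassTCube

end Summit.CriticalPhenomena.PercolationContinuityZ3.Theorems
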